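import Summits.RiemannHypothesis.RiemannHypothesis.Theorems.TiltedLandingLaw421Seam02

/-! # TiltedLandingLaw421 — descent seam, part 03
Token-identical port of the descent framework of `Cruxes/TiltedLandingLaw421/Lines/law421birthS.lean`
(seam canon ce03e18b) into flat Theorems modules, so that crux line files can import it instead of inlining it.
No new mathematics; no `sorry`; no route (Theses) imports — the tree statement is mirrored as `RhW07.Seam.Law421Statement`. -/

namespace RhIdea6.G18.W07C8.Law421BirthS
open Set Complex
open Literature.NumberTheory.LFunctions Literature.NumberTheory.DiophantineGeometry
open Summit.RiemannHypothesis.RiemannHypothesis.Theses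
open Summit.RiemannHypothesis.RiemannHypothesis.Theorems.Splittings.JensenWindow (LocalA)
open Summit.RiemannHypothesis.RiemannHypothesis.Theorems.Splittings.EarlyAppointmentsLocalFourierPolya
open RhIdea6.G17.W07C7 RhIdea6.G17.W07C7.Rev6

/-- `law421_ofS` — seam of the TiltedLandingLaw421 descent framework, part 03 (token-identical port of `Cruxes/TiltedLandingLaw421/Lines/law421birthS.lean`; no new mathematics). -/
theorem law421_ofS (hDesc : DescentSigS) (hHer : AnalyticHereditySig) : SeamTiltedLandingLaw421 := by
  intro η f x₀ s hmax R Hs B hE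
  have hE' := hE
  obtain ⟨hdiff, hreal, hgrowth, hs, hsh, hhR, h3R, hHs, hstrip, hHsR, hpair, hcol, hhalf, hη0, hη1, hrem⟩ := hE'
  have hC0 : InClass f Hs := ⟨hdiff, hreal, hgrowth, hstrip⟩
  obtain ⟨j, α, β, H, hj, hα, hβ, hnz, hW⟩ := hDesc η f x₀ s hmax R Hs B hE
  obtain ⟨hlt, hH, hgα, hgβ, hdα, hdβ, htop, hleft, hright, hA, hz⟩ := hW

  have hCj : InClass (iteratedDeriv j f) Hs := hHer f Hs j hHs hC0 hnz

  obtain ⟨x, hxI, hdx, hgx, hsign⟩ :=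
    exists_nonLaguerre_critical_of_boundary_sign hCj.1 hCj.2.1 hlt hH hgα hgβ hdα hdβ htop hleft hright hA hz

  have h1 : iteratedDeriv (j + 1) f = deriv (iteratedDeriv j f) := iteratedDeriv_succ
  have h2 : iteratedDeriv (j + 2) f = deriv (deriv (iteratedDeriv j f)) := by
    show iteratedDeriv (j + 1 + 1) f = _
    rw [iteratedDeriv_succ, iteratedDeriv_succ]
  have hgim : (iteratedDeriv j f (x : ℂ)).im = 0 := hCj.2.1 x
  have hev : NLEventOf f j x := by
    refine ⟨?_, ?_, ?_⟩
    · rw [h1, hdx]; simp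
    · intro hre
      exact hgx (Complex.ext (by simpa using hre) (by simpa using hgim))
    · rw [h2]
      have hmul : (iteratedDeriv j f (x : ℂ) * deriv (deriv (iteratedDeriv j f)) (x : ℂ)).re =
          (iteratedDeriv j f (x : ℂ)).re * (deriv (deriv (iteratedDeriv j f)) (x : ℂ)).re := by
        rw [Complex.mul_re, hgim, zero_mul, sub_zero]
      rw [← hmul]; exact hsign
  refine ⟨j, ?_, x, ?_, hev⟩
  · have : (1 : ℝ) * (Hs / s) ^ 2 = (Hs / s) ^ 2 := one_mul _
    linarith
  · rw [abs_sub_lt_iff]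
    constructor <;> linarith [hxI.1, hxI.2]

/-- `law421_of` — seam of the TiltedLandingLaw421 descent framework, part 03 (token-identical port of `Cruxes/TiltedLandingLaw421/Lines/law421birthS.lean`; no new mathematics). -/
theorem law421_of (hDesc : DescentSig) (hSign : OffJensenSignSig) (hHer : AnalyticHereditySig) : SeamTiltedLandingLaw421 :=
  law421_ofS (descentSigS_of_descentSig hSign hHer hDesc) hHer

example : SeamTiltedLandingLaw421 = TiltedLandingLaw5 4 2 1 := rfl

end RhIdea6.G18.W07C8.Law421BirthS
namespace RhIdea6.G18.W07C8.Law421BirthS.Split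
open Set Complex
open RhIdea6.G17.W07C7 RhIdea6.G17.W07C7.Rev6 RhIdea6.G18.W07C8.Law421BirthS
/-- `BudgetSig` — seam of the TiltedLandingLaw421 descent framework, part 03 (token-identical port of `Cruxes/TiltedLandingLaw421/Lines/law421birthS.lean`; no new mathematics). -/
def BudgetSig (Iso : (ℂ → ℂ) → ℝ → ℝ → ℂ → Prop) : Prop := ∀ (η : ℝ) (f : ℂ → ℂ) (x₀ s hmax R Hs : ℝ) (B : ℕ),
  EngineHyps5 2 η f x₀ s hmax R Hs B →
    ∃ (j : ℕ) (u : ℂ), (j : ℝ) ≤ 4 * hmax / s + (Hs / s) ^ 2 + B ∧ |u.re - x₀| ≤ (j + 2) * R / 2 ∧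
      iteratedDeriv j f ≠ 0 ∧ iteratedDeriv j f u = 0 ∧ u.im ≠ 0 ∧ Iso (iteratedDeriv j f) Hs R u

/-- `WindowSig` — seam of the TiltedLandingLaw421 descent framework, part 03 (token-identical port of `Cruxes/TiltedLandingLaw421/Lines/law421birthS.lean`; no new mathematics). -/
def WindowSig (Iso : (ℂ → ℂ) → ℝ → ℝ → ℂ → Prop) : Prop := ∀ (g : ℂ → ℂ) (Hs R : ℝ) (u : ℂ),
  InClass g Hs → g ≠ 0 → g u = 0 → u.im ≠ 0 → Iso g Hs R u →
    ∃ (α β H : ℝ), u.re - R / 2 ≤ α ∧ β ≤ u.re + R / 2 ∧ SignWindow g α β H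

/-- `descentSigS_of_budget_window` — seam of the TiltedLandingLaw421 descent framework, part 03 (token-identical port of `Cruxes/TiltedLandingLaw421/Lines/law421birthS.lean`; no new mathematics). -/
theorem descentSigS_of_budget_window (Iso : (ℂ → ℂ) → ℝ → ℝ → ℂ → Prop)
    (hB : BudgetSig Iso) (hW : WindowSig Iso) (hHer : AnalyticHereditySig) : DescentSigS := by
  intro η f x₀ s hmax R Hs B hE
  have hE' := hE
  obtain ⟨hdiff, hreal, hgrowth, hs, hsh, hhR, h3R, hHs, hstrip, hHsR, hpair, hcol, hhalf, hη0, hη1, hrem⟩ := hE'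
  obtain ⟨j, u, hj, hu, hnz, hzu, huim, hiso⟩ := hB η f x₀ s hmax R Hs B hE
  have hCj : InClass (iteratedDeriv j f) Hs := hHer f Hs j hHs ⟨hdiff, hreal, hgrowth, hstrip⟩ hnz
  obtain ⟨α, β, H, hα, hβ, hSW⟩ := hW _ Hs R u hCj hnz hzu huim hiso
  refine ⟨j, α, β, H, hj, ?_, ?_, hnz, hSW⟩
  · have h1 := (abs_le.1 hu).1
    linarith
  · have h2 := (abs_le.1 hu).2
    linarith

/-- `law421_of_budget_window` — seam of the TiltedLandingLaw421 descent framework, part 03 (token-identical port of `Cruxes/TiltedLandingLaw421/Lines/law421birthS.lean`; no new mathematics). -/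
theorem law421_of_budget_window (Iso : (ℂ → ℂ) → ℝ → ℝ → ℂ → Prop)
    (hB : BudgetSig Iso) (hW : WindowSig Iso) (hHer : AnalyticHereditySig) : SeamTiltedLandingLaw421 :=
  law421_ofS (descentSigS_of_budget_window Iso hB hW hHer) hHer

/-- `ScaleIsolated` — seam of the TiltedLandingLaw421 descent framework, part 03 (token-identical port of `Cruxes/TiltedLandingLaw421/Lines/law421birthS.lean`; no new mathematics). -/
def ScaleIsolated (K : ℝ) (g : ℂ → ℂ) (_Hs R : ℝ) (u : ℂ) : Prop :=
  K * |u.im| ≤ R / 2 ∧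
    (∀ v : ℂ, g v = 0 → v ≠ u → v ≠ (starRingEnd ℂ) u → |v.re - u.re| < K * |u.im| → v.im = 0 ∨ K * |u.im| ≤ |v.im|) ∧
    (∀ ρ : ℂ, deriv g ρ = 0 → |ρ.re - u.re| < K * |u.im| → |ρ.im| < K * |u.im| → ρ.im = 0)

example (K : ℝ) (hB : BudgetSig (ScaleIsolated K)) (hW : WindowSig (ScaleIsolated K)) (hHer : AnalyticHereditySig) :
    SeamTiltedLandingLaw421 :=
  law421_of_budget_window (ScaleIsolated K) hB hW hHer

end RhIdea6.G18.W07C8.Law421BirthS.Split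
namespace RhIdea3.G21.W07C9.Iso
open Complex Metric
/-- `IsoDom` — seam of the TiltedLandingLaw421 descent framework, part 03 (token-identical port of `Cruxes/TiltedLandingLaw421/Lines/law421birthS.lean`; no new mathematics). -/
def IsoDom (g : ℂ → ℂ) (Hs R : ℝ) (u : ℂ) : Prop :=
  0 < u.im ∧ 6 * u.im ≤ R ∧ u.im ≤ Hs ∧
  (∃ (h : ℂ → ℂ) (K K' : ℝ), Differentiable ℂ h ∧ (∀ x : ℝ, (h x).im = 0) ∧
      (∀ w, g w = ((w - u.re) ^ 2 + (u.im : ℂ) ^ 2) * h w) ∧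
      (∀ z ∈ closedBall (u.re : ℂ) u.im, h z ≠ 0) ∧
      (∀ z ∈ closedBall (u.re : ℂ) u.im, ‖deriv h z / h z‖ ≤ K) ∧
      (∀ z ∈ closedBall (u.re : ℂ) u.im, ‖deriv (fun w ↦ deriv h w / h w) z‖ ≤ K') ∧
      K * u.im + K' * u.im ^ 2 < 1) ∧
  (∀ w, deriv g w = 0 → |w.re - u.re| < 3 * u.im → |w.im| < 2 * u.im → w.im ≠ 0 →
      ‖w - u.re‖ ≤ u.im) ∧
  (∃ V : Finset ℂ,
      (∀ v, g v = 0 → 0 < v.im → v ≠ u → |v.re - u.re| < v.im + 3 * u.im →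
          v ∈ V ∧ 2 * u.im < v.im) ∧
      ∑ v ∈ V, ((analyticOrderAt g v).toNat : ℝ) * (2 * v.im ^ 2 / (v.im - 2 * u.im) ^ 4)
        < 1 / (54 * u.im ^ 2))

end RhIdea3.G21.W07C9.Iso
namespace RhIdea6.G18.W07C8.Law421BirthS.Split
open Set Complex Metric
open RhIdea6.G17.W07C7 RhIdea6.G17.W07C7.Rev6 RhIdea6.G18.W07C8.Law421BirthS RhIdea3.G21.W07C9.Iso
/-- `budgetSig_mono` — seam of the TiltedLandingLaw421 descent framework, part 03 (token-identical port of `Cruxes/TiltedLandingLaw421/Lines/law421birthS.lean`; no new mathematics). -/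
theorem budgetSig_mono {Iso₁ Iso₂ : (ℂ → ℂ) → ℝ → ℝ → ℂ → Prop}
    (hI : ∀ g Hs R u, Iso₁ g Hs R u → Iso₂ g Hs R u) (hB : BudgetSig Iso₁) : BudgetSig Iso₂ := by
  intro η f x₀ s hmax R Hs B hE
  obtain ⟨j, u, hj, hu, hnz, hzu, huim, hiso⟩ := hB η f x₀ s hmax R Hs B hE
  exact ⟨j, u, hj, hu, hnz, hzu, huim, hI _ _ _ _ hiso⟩

/-- `windowSig_anti` — seam of the TiltedLandingLaw421 descent framework, part 03 (token-identical port of `Cruxes/TiltedLandingLaw421/Lines/law421birthS.lean`; no new mathematics). -/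
theorem windowSig_anti {Iso₁ Iso₂ : (ℂ → ℂ) → ℝ → ℝ → ℂ → Prop}
    (hI : ∀ g Hs R u, Iso₁ g Hs R u → Iso₂ g Hs R u) (hW : WindowSig Iso₂) : WindowSig Iso₁ :=
  fun g Hs R u hC hnz hzu huim hiso => hW g Hs R u hC hnz hzu huim (hI _ _ _ _ hiso)

/-- `IsoDomC` — seam of the TiltedLandingLaw421 descent framework, part 03 (token-identical port of `Cruxes/TiltedLandingLaw421/Lines/law421birthS.lean`; no new mathematics). -/
def IsoDomC (g : ℂ → ℂ) (Hs R : ℝ) (u : ℂ) : Prop :=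
  0 < u.im ∧ 6 * u.im ≤ R ∧ u.im ≤ Hs ∧
  (∃ (h : ℂ → ℂ), Differentiable ℂ h ∧ (∀ x : ℝ, (h x).im = 0) ∧
      (∀ w, g w = ((w - u.re) ^ 2 + (u.im : ℂ) ^ 2) * h w) ∧
      (∀ z ∈ closedBall (u.re : ℂ) u.im, h z ≠ 0)) ∧
  (∀ w, deriv g w = 0 → |w.re - u.re| < 3 * u.im → |w.im| < 2 * u.im → w.im = 0) ∧
  (∃ V : Finset ℂ,
      (∀ v, g v = 0 → 0 < v.im → v ≠ u → |v.re - u.re| < v.im + 3 * u.im →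
          v ∈ V ∧ 2 * u.im < v.im) ∧
      ∑ v ∈ V, ((analyticOrderAt g v).toNat : ℝ) * (2 * v.im ^ 2 / (v.im - 2 * u.im) ^ 4)
        < 1 / (54 * u.im ^ 2))

/-- `isoDomC_of_isoDom` — seam of the TiltedLandingLaw421 descent framework, part 03 (token-identical port of `Cruxes/TiltedLandingLaw421/Lines/law421birthS.lean`; no new mathematics). -/
theorem isoDomC_of_isoDom
    (hL : ∀ (g h : ℂ → ℂ) (a ε K K' : ℝ), 0 < ε → Differentiable ℂ h → (∀ x : ℝ, (h x).im = 0) →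
      (∀ w, g w = ((w - a) ^ 2 + (ε : ℂ) ^ 2) * h w) → (∀ z ∈ closedBall (a : ℂ) ε, h z ≠ 0) →
      (∀ z ∈ closedBall (a : ℂ) ε, ‖deriv h z / h z‖ ≤ K) →
      (∀ z ∈ closedBall (a : ℂ) ε, ‖deriv (fun w ↦ deriv h w / h w) z‖ ≤ K') → K * ε + K' * ε ^ 2 < 1 →
      ∀ w, deriv g w = 0 → ‖w - a‖ ≤ ε → w.im = 0)
    (g : ℂ → ℂ) (Hs R : ℝ) (u : ℂ) (hI : IsoDom g Hs R u) : IsoDomC g Hs R u := by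
  obtain ⟨hε, hR, hHs, ⟨h, K, K', hhd, hhr, hfac, hnz, hK, hK', hcrit⟩, hdesc, hdom⟩ := hI
  refine ⟨hε, hR, hHs, ⟨h, hhd, hhr, hfac, hnz⟩, ?_, hdom⟩
  intro w hw hre him
  by_contra hne
  have hdisc : ‖w - u.re‖ ≤ u.im := hdesc w hw hre him hne
  exact hne (hL g h u.re u.im K K' hε hhd hhr hfac hnz hK hK' hcrit w hw hdisc)

/-- `budgetSig_isoDomC_of_isoDom` — seam of the TiltedLandingLaw421 descent framework, part 03 (token-identical port of `Cruxes/TiltedLandingLaw421/Lines/law421birthS.lean`; no new mathematics). -/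
theorem budgetSig_isoDomC_of_isoDom
    (hL : ∀ (g h : ℂ → ℂ) (a ε K K' : ℝ), 0 < ε → Differentiable ℂ h → (∀ x : ℝ, (h x).im = 0) →
      (∀ w, g w = ((w - a) ^ 2 + (ε : ℂ) ^ 2) * h w) → (∀ z ∈ closedBall (a : ℂ) ε, h z ≠ 0) →
      (∀ z ∈ closedBall (a : ℂ) ε, ‖deriv h z / h z‖ ≤ K) →
      (∀ z ∈ closedBall (a : ℂ) ε, ‖deriv (fun w ↦ deriv h w / h w) z‖ ≤ K') → K * ε + K' * ε ^ 2 < 1 →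
      ∀ w, deriv g w = 0 → ‖w - a‖ ≤ ε → w.im = 0)
    (hB : BudgetSig IsoDom) : BudgetSig IsoDomC :=
  budgetSig_mono (fun g Hs R u hI => isoDomC_of_isoDom hL g Hs R u hI) hB

/-- `law421_of_splitDomC` — seam of the TiltedLandingLaw421 descent framework, part 03 (token-identical port of `Cruxes/TiltedLandingLaw421/Lines/law421birthS.lean`; no new mathematics). -/
theorem law421_of_splitDomC (hB : BudgetSig IsoDomC) (hW : WindowSig IsoDomC) (hHer : AnalyticHereditySig) : SeamTiltedLandingLaw421 :=
  law421_of_budget_window IsoDomC hB hW hHer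

end RhIdea6.G18.W07C8.Law421BirthS.Split
namespace RhIdea6.G18.W07C8.Law421BirthS
open Set Complex
open RhIdea6.G17.W07C7 RhIdea6.G17.W07C7.Rev6
/-- `law421_tree_iff` — seam of the TiltedLandingLaw421 descent framework, part 03 (token-identical port of `Cruxes/TiltedLandingLaw421/Lines/law421birthS.lean`; no new mathematics). -/
theorem law421_tree_iff : RhW07.Seam.Law421Statement ↔ SeamTiltedLandingLaw421 := by
  constructor
  · intro h η f x₀ s hmax R Hs B hE
    obtain ⟨hdiff, hreal, hgrowth, hs, hsh, hhR, h3R, hHs, hstrip, hHsR, hpair, hcol, hhalf, hη0, hη1, hrem⟩ := hE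
    obtain ⟨k, hk, x, hx, hNL⟩ := h η f x₀ s hmax R Hs B hdiff hreal hgrowth hs hsh hhR h3R hHs hstrip hHsR hpair hcol hhalf hη0 hη1 hrem
    exact ⟨k, by linarith, x, hx, hNL⟩
  · intro h η f x₀ s hmax R Hs B hdiff hreal hgrowth hs hsh hhR h3R hHs hstrip hHsR hpair hcol hhalf hη0 hη1 hrem
    obtain ⟨k, hk, x, hx, hNL⟩ := h η f x₀ s hmax R Hs B
      ⟨hdiff, hreal, hgrowth, hs, hsh, hhR, h3R, hHs, hstrip, hHsR, hpair, hcol, hhalf, hη0, hη1, hrem⟩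
    exact ⟨k, by linarith, x, hx, hNL⟩

/-- `law421T_ofS` — seam of the TiltedLandingLaw421 descent framework, part 03 (token-identical port of `Cruxes/TiltedLandingLaw421/Lines/law421birthS.lean`; no new mathematics). -/
theorem law421T_ofS (hDesc : DescentSigS) (hHer : AnalyticHereditySig) :
    RhW07.Seam.Law421Statement :=
  law421_tree_iff.mpr (law421_ofS hDesc hHer)

/-- `law421T_of_budget_window` — seam of the TiltedLandingLaw421 descent framework, part 03 (token-identical port of `Cruxes/TiltedLandingLaw421/Lines/law421birthS.lean`; no new mathematics). -/
theorem law421T_of_budget_window (Iso : (ℂ → ℂ) → ℝ → ℝ → ℂ → Prop)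
    (hB : Split.BudgetSig Iso) (hW : Split.WindowSig Iso) (hHer : AnalyticHereditySig) :
    RhW07.Seam.Law421Statement :=
  law421_tree_iff.mpr (Split.law421_of_budget_window Iso hB hW hHer)

/-- `law421T_of_splitDomC` — seam of the TiltedLandingLaw421 descent framework, part 03 (token-identical port of `Cruxes/TiltedLandingLaw421/Lines/law421birthS.lean`; no new mathematics). -/
private theorem law421T_of_splitDomC (hB : Split.BudgetSig Split.IsoDomC) (hW : Split.WindowSig Split.IsoDomC) (hHer : AnalyticHereditySig) :
    RhW07.Seam.Law421Statement :=
  law421T_of_budget_window Split.IsoDomC hB hW hHer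

end RhIdea6.G18.W07C8.Law421BirthS
namespace RhIdea5.G17.W07C9.Helpers
open Set Complex
open Summit.RiemannHypothesis.RiemannHypothesis.Theorems.Splittings.JensenWindow (LocalA)
/-- `RemainderBox` — seam of the TiltedLandingLaw421 descent framework, part 03 (token-identical port of `Cruxes/TiltedLandingLaw421/Lines/law421birthS.lean`; no new mathematics). -/
def RemainderBox (η : ℝ) (f : ℂ → ℂ) (x₀ s hmax R : ℝ) : Prop :=
  ∀ w : ℂ, |w.re - x₀| ≤ R / 2 → |w.im| ≤ hmax → f w ≠ 0 →
    ‖deriv f w / f w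
        - ∑ᶠ u ∈ {u : ℂ | f u = 0 ∧ |u.re - w.re| < R / 2}, ((analyticOrderAt f u).toNat : ℂ) * (w - u)⁻¹‖ ≤ η / s

/-- `ColumnBudgetMult` — seam of the TiltedLandingLaw421 descent framework, part 03 (token-identical port of `Cruxes/TiltedLandingLaw421/Lines/law421birthS.lean`; no new mathematics). -/
def ColumnBudgetMult (B : ℕ) (f : ℂ → ℂ) (x₀ s R : ℝ) : Prop :=
  ∀ r : ℝ, s ≤ r → r ≤ R →
    (∑ᶠ u ∈ {u : ℂ | f u = 0 ∧ |u.re - x₀| ≤ r}, ((analyticOrderAt f u).toNat : ℝ)) - 2 * r / s ≤ B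

/-- `HalfSlabBudget` — seam of the TiltedLandingLaw421 descent framework, part 03 (token-identical port of `Cruxes/TiltedLandingLaw421/Lines/law421birthS.lean`; no new mathematics). -/
def HalfSlabBudget (B : ℕ) (f : ℂ → ℂ) (x₀ s R : ℝ) : Prop :=
  ∀ r : ℝ, s ≤ r → r ≤ R →
    |(∑ᶠ u ∈ {u : ℂ | f u = 0 ∧ x₀ < u.re ∧ u.re ≤ x₀ + r}, ((analyticOrderAt f u).toNat : ℝ)) - r / s| ≤ 1 + B ∧
    |(∑ᶠ u ∈ {u : ℂ | f u = 0 ∧ x₀ - r ≤ u.re ∧ u.re < x₀}, ((analyticOrderAt f u).toNat : ℝ)) - r / s| ≤ 1 + B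

/-- `EngineHyps5` — seam of the TiltedLandingLaw421 descent framework, part 03 (token-identical port of `Cruxes/TiltedLandingLaw421/Lines/law421birthS.lean`; no new mathematics). -/
def EngineHyps5 (C η : ℝ) (f : ℂ → ℂ) (x₀ s hmax R Hs : ℝ) (B : ℕ) : Prop :=
  Differentiable ℂ f ∧ (∀ x : ℝ, (f (x : ℂ)).im = 0) ∧
    (∃ A' B' ρ : ℝ, ρ < 2 ∧ ∀ z : ℂ, ‖f z‖ ≤ A' * Real.exp (B' * ‖z‖ ^ ρ)) ∧
    0 < s ∧ C * s ≤ hmax ∧ C * hmax ≤ R ∧ 3 * hmax < R ∧ 0 ≤ Hs ∧ (∀ w : ℂ, f w = 0 → |w.im| ≤ Hs) ∧ C * Hs ≤ R ∧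
    (∃ w₀ : ℂ, f w₀ = 0 ∧ w₀.im ≠ 0 ∧ w₀.re = x₀ ∧ |w₀.im| ≤ hmax) ∧
    ColumnBudgetMult B f x₀ s R ∧ HalfSlabBudget B f x₀ s R ∧
    0 ≤ η ∧ C * η ≤ 1 ∧ RemainderBox η f x₀ s hmax R

/-- `InClass` — seam of the TiltedLandingLaw421 descent framework, part 03 (token-identical port of `Cruxes/TiltedLandingLaw421/Lines/law421birthS.lean`; no new mathematics). -/
def InClass (g : ℂ → ℂ) (Hs : ℝ) : Prop :=
  Differentiable ℂ g ∧ (∀ t : ℝ, (g (t : ℂ)).im = 0) ∧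
    (∃ A' B' ρ : ℝ, ρ < 2 ∧ ∀ z : ℂ, ‖g z‖ ≤ A' * Real.exp (B' * ‖z‖ ^ ρ)) ∧
    (∀ w : ℂ, g w = 0 → |w.im| ≤ Hs)

/-- `OffJensenDiscs` — seam of the TiltedLandingLaw421 descent framework, part 03 (token-identical port of `Cruxes/TiltedLandingLaw421/Lines/law421birthS.lean`; no new mathematics). -/
def OffJensenDiscs (g : ℂ → ℂ) (p : ℂ) : Prop :=
  ∀ u : ℂ, g u = 0 → u.im ≠ 0 → u.im ^ 2 < (p.re - u.re) ^ 2 + p.im ^ 2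

/-- `SignWindow` — seam of the TiltedLandingLaw421 descent framework, part 03 (token-identical port of `Cruxes/TiltedLandingLaw421/Lines/law421birthS.lean`; no new mathematics). -/
def SignWindow (g : ℂ → ℂ) (α β H : ℝ) : Prop :=
  α < β ∧ 0 < H ∧ g α ≠ 0 ∧ g β ≠ 0 ∧ deriv g α ≠ 0 ∧ deriv g β ≠ 0 ∧
    (∀ x ∈ Icc α β, (deriv g ((x : ℂ) + (H : ℂ) * I) / g ((x : ℂ) + (H : ℂ) * I)).im < 0) ∧
    (∀ y ∈ Ioc (0 : ℝ) H, (deriv g ((α : ℂ) + (y : ℂ) * I) / g ((α : ℂ) + (y : ℂ) * I)).im < 0) ∧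
    (∀ y ∈ Ioc (0 : ℝ) H, (deriv g ((β : ℂ) + (y : ℂ) * I) / g ((β : ℂ) + (y : ℂ) * I)).im < 0) ∧
    LocalA g α β H ∧ (∃ ρ ∈ Ioo α β ×ℂ Ioo (-H) H, g ρ = 0 ∧ ρ.im ≠ 0)

/-- `DescentSigS` — seam of the TiltedLandingLaw421 descent framework, part 03 (token-identical port of `Cruxes/TiltedLandingLaw421/Lines/law421birthS.lean`; no new mathematics). -/
def DescentSigS : Prop := ∀ (η : ℝ) (f : ℂ → ℂ) (x₀ s hmax R Hs : ℝ) (B : ℕ),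
  EngineHyps5 2 η f x₀ s hmax R Hs B →
    ∃ (j : ℕ) (α β H : ℝ), (j : ℝ) ≤ 4 * hmax / s + (Hs / s) ^ 2 + B ∧
      x₀ - (j + 3) * R / 2 ≤ α ∧ β ≤ x₀ + (j + 3) * R / 2 ∧
      iteratedDeriv j f ≠ 0 ∧ SignWindow (iteratedDeriv j f) α β H

/-- `OffJensenSignSig` — seam of the TiltedLandingLaw421 descent framework, part 03 (token-identical port of `Cruxes/TiltedLandingLaw421/Lines/law421birthS.lean`; no new mathematics). -/
def OffJensenSignSig : Prop := ∀ (g : ℂ → ℂ) (Hs : ℝ) (p : ℂ),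
  InClass g Hs → g ≠ 0 → (∃ u : ℂ, g u = 0) → 0 < p.im → OffJensenDiscs g p → (deriv g p / g p).im < 0

/-- `AnalyticHereditySig` — seam of the TiltedLandingLaw421 descent framework, part 03 (token-identical port of `Cruxes/TiltedLandingLaw421/Lines/law421birthS.lean`; no new mathematics). -/
def AnalyticHereditySig : Prop := ∀ (f : ℂ → ℂ) (Hs : ℝ) (j : ℕ),
  0 ≤ Hs → InClass f Hs → iteratedDeriv j f ≠ 0 → InClass (iteratedDeriv j f) Hs

/-- `pairTerm` — seam of the TiltedLandingLaw421 descent framework, part 03 (token-identical port of `Cruxes/TiltedLandingLaw421/Lines/law421birthS.lean`; no new mathematics). -/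
noncomputable def pairTerm (m : ℕ) (p u : ℂ) : ℝ :=
  -2 * (m : ℝ) * p.im * ((p.re - u.re) ^ 2 + p.im ^ 2 - u.im ^ 2) /
    (Complex.normSq (p - u) * Complex.normSq (p - (starRingEnd ℂ) u))

/-- `DominatedAt` — seam of the TiltedLandingLaw421 descent framework, part 03 (token-identical port of `Cruxes/TiltedLandingLaw421/Lines/law421birthS.lean`; no new mathematics). -/
def DominatedAt (g : ℂ → ℂ) (p : ℂ) : Prop :=
  ∃ (u₀ : ℂ) (S : Finset ℂ), g u₀ = 0 ∧ 0 < u₀.im ∧ u₀ ∉ S ∧ (∀ u ∈ S, 0 < u.im) ∧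
    (∀ u : ℂ, g u = 0 → 0 < u.im → u ≠ u₀ → (p.re - u.re) ^ 2 + p.im ^ 2 ≤ u.im ^ 2 → u ∈ S) ∧
    pairTerm (analyticOrderAt g u₀).toNat p u₀ + ∑ u ∈ S, pairTerm (analyticOrderAt g u).toNat p u < 0

/-- `BoundaryOK` — seam of the TiltedLandingLaw421 descent framework, part 03 (token-identical port of `Cruxes/TiltedLandingLaw421/Lines/law421birthS.lean`; no new mathematics). -/
def BoundaryOK (g : ℂ → ℂ) (p : ℂ) : Prop :=
  g p ≠ 0 ∧ (OffJensenDiscs g p ∨ DominatedAt g p)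

/-- `InDiscDominanceSig` — seam of the TiltedLandingLaw421 descent framework, part 03 (token-identical port of `Cruxes/TiltedLandingLaw421/Lines/law421birthS.lean`; no new mathematics). -/
def InDiscDominanceSig : Prop := ∀ (g : ℂ → ℂ) (Hs : ℝ) (p : ℂ),
  InClass g Hs → g ≠ 0 → 0 < p.im → g p ≠ 0 → DominatedAt g p → (deriv g p / g p).im < 0

/-- `BudgetedLandingSig` — seam of the TiltedLandingLaw421 descent framework, part 03 (token-identical port of `Cruxes/TiltedLandingLaw421/Lines/law421birthS.lean`; no new mathematics). -/
def BudgetedLandingSig : Prop := ∀ (η : ℝ) (f : ℂ → ℂ) (x₀ s hmax R Hs : ℝ) (B : ℕ),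
  EngineHyps5 2 η f x₀ s hmax R Hs B →
    ∃ (j : ℕ) (α β H : ℝ), (j : ℝ) ≤ 4 * hmax / s + (Hs / s) ^ 2 + B ∧
      x₀ - (j + 3) * R / 2 ≤ α ∧ β ≤ x₀ + (j + 3) * R / 2 ∧
      iteratedDeriv j f ≠ 0 ∧ α < β ∧ 0 < H ∧
      iteratedDeriv j f α ≠ 0 ∧ iteratedDeriv j f β ≠ 0 ∧
      deriv (iteratedDeriv j f) α ≠ 0 ∧ deriv (iteratedDeriv j f) β ≠ 0 ∧
      LocalA (iteratedDeriv j f) α β H ∧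
      (∃ ρ ∈ Ioo α β ×ℂ Ioo (-H) H, iteratedDeriv j f ρ = 0 ∧ ρ.im ≠ 0) ∧
      (∀ x ∈ Icc α β, BoundaryOK (iteratedDeriv j f) ((x : ℂ) + (H : ℂ) * I)) ∧
      (∀ y ∈ Ioc (0 : ℝ) H, BoundaryOK (iteratedDeriv j f) ((α : ℂ) + (y : ℂ) * I)) ∧
      (∀ y ∈ Ioc (0 : ℝ) H, BoundaryOK (iteratedDeriv j f) ((β : ℂ) + (y : ℂ) * I))

/-- `PairTermCanopyBound` — seam of the TiltedLandingLaw421 descent framework, part 03 (token-identical port of `Cruxes/TiltedLandingLaw421/Lines/law421birthS.lean`; no new mathematics). -/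
def PairTermCanopyBound : Prop := ∀ (m : ℕ) (p u : ℂ), 0 < p.im → 2 * p.im ≤ u.im →
  pairTerm m p u ≤ 8 * (m : ℝ) * p.im / u.im ^ 2

/-- `PairTermLanderBound` — seam of the TiltedLandingLaw421 descent framework, part 03 (token-identical port of `Cruxes/TiltedLandingLaw421/Lines/law421birthS.lean`; no new mathematics). -/
def PairTermLanderBound : Prop := ∀ (m : ℕ) (p u₀ : ℂ), 0 < p.im → 0 < u₀.im → u₀.im ^ 2 ≤ (p.re - u₀.re) ^ 2 →
  pairTerm m p u₀ ≤ -2 * (m : ℝ) * p.im * ((p.re - u₀.re) ^ 2 - u₀.im ^ 2) / ((p.re - u₀.re) ^ 2 + (p.im + u₀.im) ^ 2) ^ 2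

/-- `sign_of_boundaryOK` — seam of the TiltedLandingLaw421 descent framework, part 03 (token-identical port of `Cruxes/TiltedLandingLaw421/Lines/law421birthS.lean`; no new mathematics). -/
theorem sign_of_boundaryOK (hSign : OffJensenSignSig) (hDom : InDiscDominanceSig) {g : ℂ → ℂ} {Hs : ℝ}
    (hcl : InClass g Hs) (hg : g ≠ 0) (hex : ∃ u : ℂ, g u = 0) {p : ℂ} (hp : 0 < p.im) (hok : BoundaryOK g p) :
    (deriv g p / g p).im < 0 := by
  rcases hok.2 with h | h
  · exact hSign g Hs p hcl hg hex hp h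
  · exact hDom g Hs p hcl hg hp hok.1 h

/-- `descentSigS_of_split` — seam of the TiltedLandingLaw421 descent framework, part 03 (token-identical port of `Cruxes/TiltedLandingLaw421/Lines/law421birthS.lean`; no new mathematics). -/
theorem descentSigS_of_split (hSign : OffJensenSignSig) (hHer : AnalyticHereditySig)
    (hDom : InDiscDominanceSig) (hLand : BudgetedLandingSig) : DescentSigS := by
  intro η f x₀ s hmax R Hs B hE
  have hE' := hE
  obtain ⟨hdiff, hreal, hgrowth, hs, hsh, hhR, h3R, hHs, hstrip, hHsR, hpair, hcol, hhalf, hη0, hη1, hrem⟩ := hE'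
  have hC0 : InClass f Hs := ⟨hdiff, hreal, hgrowth, hstrip⟩
  obtain ⟨j, α, β, H, hj, hα, hβ, hnz, hlt, hH, hgα, hgβ, hdα, hdβ, hA, hz, htop, hleft, hright⟩ :=
    hLand η f x₀ s hmax R Hs B hE
  have hCj : InClass (iteratedDeriv j f) Hs := hHer f Hs j hHs hC0 hnz
  have hex : ∃ u : ℂ, iteratedDeriv j f u = 0 := by
    obtain ⟨ρ, -, hρ, -⟩ := hz
    exact ⟨ρ, hρ⟩
  refine ⟨j, α, β, H, hj, hα, hβ, hnz, hlt, hH, hgα, hgβ, hdα, hdβ, ?_, ?_, ?_, hA, hz⟩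
  · exact fun x hx ↦ sign_of_boundaryOK hSign hDom hCj hnz hex (by rw [Literature.Analysis.Complex.im_ofReal_add_ofReal_mul_I]; exact hH) (htop x hx)
  · exact fun y hy ↦ sign_of_boundaryOK hSign hDom hCj hnz hex (by rw [Literature.Analysis.Complex.im_ofReal_add_ofReal_mul_I]; exact hy.1) (hleft y hy)
  · exact fun y hy ↦ sign_of_boundaryOK hSign hDom hCj hnz hex (by rw [Literature.Analysis.Complex.im_ofReal_add_ofReal_mul_I]; exact hy.1) (hright y hy)

/-- `BudgetSig` — seam of the TiltedLandingLaw421 descent framework, part 03 (token-identical port of `Cruxes/TiltedLandingLaw421/Lines/law421birthS.lean`; no new mathematics). -/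
def BudgetSig (Iso : (ℂ → ℂ) → ℝ → ℝ → ℂ → Prop) : Prop := ∀ (η : ℝ) (f : ℂ → ℂ) (x₀ s hmax R Hs : ℝ) (B : ℕ),
  EngineHyps5 2 η f x₀ s hmax R Hs B →
    ∃ (j : ℕ) (u : ℂ), (j : ℝ) ≤ 4 * hmax / s + (Hs / s) ^ 2 + B ∧ |u.re - x₀| ≤ (j + 2) * R / 2 ∧
      iteratedDeriv j f ≠ 0 ∧ iteratedDeriv j f u = 0 ∧ u.im ≠ 0 ∧ Iso (iteratedDeriv j f) Hs R u

/-- `WindowSig` — seam of the TiltedLandingLaw421 descent framework, part 03 (token-identical port of `Cruxes/TiltedLandingLaw421/Lines/law421birthS.lean`; no new mathematics). -/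
def WindowSig (Iso : (ℂ → ℂ) → ℝ → ℝ → ℂ → Prop) : Prop := ∀ (g : ℂ → ℂ) (Hs R : ℝ) (u : ℂ),
  InClass g Hs → g ≠ 0 → g u = 0 → u.im ≠ 0 → Iso g Hs R u →
    ∃ (α β H : ℝ), u.re - R / 2 ≤ α ∧ β ≤ u.re + R / 2 ∧ SignWindow g α β H

/-- `OKBox` — seam of the TiltedLandingLaw421 descent framework, part 03 (token-identical port of `Cruxes/TiltedLandingLaw421/Lines/law421birthS.lean`; no new mathematics). -/
def OKBox (g : ℂ → ℂ) (_Hs R : ℝ) (u : ℂ) : Prop :=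
  ∃ (α β H : ℝ), u.re - R / 2 ≤ α ∧ β ≤ u.re + R / 2 ∧ α < β ∧ 0 < H ∧
    g α ≠ 0 ∧ g β ≠ 0 ∧ deriv g α ≠ 0 ∧ deriv g β ≠ 0 ∧ LocalA g α β H ∧
    (∃ ρ ∈ Ioo α β ×ℂ Ioo (-H) H, g ρ = 0 ∧ ρ.im ≠ 0) ∧
    (∀ x ∈ Icc α β, BoundaryOK g ((x : ℂ) + (H : ℂ) * I)) ∧
    (∀ y ∈ Ioc (0 : ℝ) H, BoundaryOK g ((α : ℂ) + (y : ℂ) * I)) ∧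
    (∀ y ∈ Ioc (0 : ℝ) H, BoundaryOK g ((β : ℂ) + (y : ℂ) * I))

/-- `windowSig_OKBox` — seam of the TiltedLandingLaw421 descent framework, part 03 (token-identical port of `Cruxes/TiltedLandingLaw421/Lines/law421birthS.lean`; no new mathematics). -/
theorem windowSig_OKBox (hSign : OffJensenSignSig) (hDom : InDiscDominanceSig) : WindowSig OKBox := by
  intro g Hs R u hcl hg hzu _huim hiso
  obtain ⟨α, β, H, hα, hβ, hlt, hH, hgα, hgβ, hdα, hdβ, hA, hz, htop, hleft, hright⟩ := hiso
  have hex : ∃ v : ℂ, g v = 0 := ⟨u, hzu⟩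
  refine ⟨α, β, H, hα, hβ, hlt, hH, hgα, hgβ, hdα, hdβ, ?_, ?_, ?_, hA, hz⟩
  · exact fun x hx ↦ sign_of_boundaryOK hSign hDom hcl hg hex (by rw [Literature.Analysis.Complex.im_ofReal_add_ofReal_mul_I]; exact hH) (htop x hx)
  · exact fun y hy ↦ sign_of_boundaryOK hSign hDom hcl hg hex (by rw [Literature.Analysis.Complex.im_ofReal_add_ofReal_mul_I]; exact hy.1) (hleft y hy)
  · exact fun y hy ↦ sign_of_boundaryOK hSign hDom hcl hg hex (by rw [Literature.Analysis.Complex.im_ofReal_add_ofReal_mul_I]; exact hy.1) (hright y hy)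


end RhIdea5.G17.W07C9.Helpers
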